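import Summits.SmoothPoincare4.SmoothPoincare4.Theorems.ConvexBisectionAcyclicBisectionExistsPageRotationSchedule
import Mathlib.Analysis.InnerProductSpace.Calculus
import HarnessLib

/-!
# The sector-supported fibred page rotation of the Lefschetz base (N1-rot)
(wave 6, brick N1-rot of stub `stub_M2geo` = node N1 "one signed Hurwitz move realised
geometrically on fibred data", line `modp-braid-orbits`, crux `ConvexBisection.AcyclicBisectionExists`,
item stmt-SmoothPoincare4-10508; registered sub-goal `helper_rotFlow_sector`)

A Hurwitz move of a Lefschetz link over `Base g` moves ONE 2-handle through a sector of page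
angles while all other handles stay put (Gompf–Stipsicz 1999, §8.2; on the handlebody of Kas
1980 the critical value travels inside the base disc and its vanishing cycle is dragged along the
pages it visits).  The base-level engine is an ambient isotopy of `Base g` which rotates the pages
of a SECTOR of directions and is the identity on the pages outside it.  The rigid rotation of all
pages (`helper_rotFlow_page`, constant profile) and W1's dilation schedule
(`helper_exists_pageRotation`, all pages move) do not serve; this file runs the profiled
page-rotation field `rotFieldA g a = a(w) · rotField g` (`…PageRotationFlow.lean`) with an
ANGULAR profile

  `a = secProfile B δ`,  `secProfile B δ z = radCut δ ‖z‖² · B (z / ‖z‖)`,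

`B : ℂ → ℝ` any smooth function (only its values on the unit circle matter: the angular speed of
the page of direction `u`), cut off smoothly in `‖z‖ ≤ δ/2` so that `a` is smooth on `ℂ` (an
angular profile which is not constant cannot be smooth at `w = 0`: the binding of `∂ Base g` is
rigid, cf. the lead's rigidity remark recorded in `…HurwitzReduction.lean`).  Consequences
(`rotFlow_sector`, registered selection `helper_rotFlow_sector`):

* the flow fixes every point whose page direction `u = w/‖w‖` has `B u = 0`, and the binding
  `w = 0` (zeros of the field, `helper_rotFlow_fix`): pages outside the support of `B|_{S¹}` do
  not move;
* **exact fibredness off the binding**: on `{‖w‖ ≥ δ}` the direction `u(t) = w(t)/‖w(0)‖` of a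
  flow line solves the AUTONOMOUS unit-circle ODE `u' = B(u) · i · u` (`‖w‖` is a first integral),
  so two points on the same `w`-ray stay on a common ray with the same ratio
  (`w y = r · w x ⇒ w (R_t y) = r · w (R_t x)`, uniqueness `ODE_solution_unique_univ`); in
  particular flat pages go to flat pages;
* **plateaux rotate rigidly**: if `B = κ` on the arc `e^{i(φ₀ + κ s)}`, `s ∈ [0, T]`, then a point
  with `w = ‖w‖ e^{iφ₀}`, `‖w‖ ≥ δ`, has `w (R_t x) = ‖w‖ e^{i(φ₀ + κ t)}` for `t ∈ [0, T]`
  (comparison with the explicit solution, `ODE_solution_unique_of_mem_Icc_right`).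

So with `B` a bump equal to `κ = θ₁ − θ₀` on `[θ₀, θ₁]` and supported in a free sector, `R₁`
carries `page g e^{iθ₀}` onto `page g e^{iθ₁}` and is the identity on the pages of the other
handles.  Everything is proved; no named facts, no `sorry`.  References: R. E. Gompf,
A. I. Stipsicz, *4-Manifolds and Kirby Calculus* (1999), §8.2 [GompfStipsicz1999]; R. İ. Baykur,
AGT 6 (2006), proof of Thm. 5.1 [Baykur2006]; J. M. Lee, *Introduction to Smooth Manifolds*
(2012), Thm. 9.12 [LeeSmoothManifolds2013].
-/

noncomputable section

set_option linter.dupNamespace false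

open scoped Manifold ContDiff Topology Real
open Set Function Metric
open Literature.Topology.FourManifolds Literature.Topology.FourManifolds.LefschetzBase

namespace Summit.SmoothPoincare4.SmoothPoincare4.Theorems.AcyclicBisectionExists.ModpBraidOrbits

/-! ## §1 The radial cut-off, the unit direction and the sector profile -/

/-- The radial cut-off `S(4s/δ² − 1)` (`S = smoothTransition`) in the variable `s = ‖z‖²`:
`0` for `s ≤ δ²/4`, `1` for `s ≥ δ²/2`. [folklore] -/
def radCut (δ s : ℝ) : ℝ := Real.smoothTransition (4 * s / δ ^ 2 - 1)

/-- The radial cut-off is `1` from `s = δ²/2` on. [folklore] -/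
theorem radCut_eq_one {δ s : ℝ} (hδ : 0 < δ) (hs : δ ^ 2 / 2 ≤ s) : radCut δ s = 1 := by
  rw [radCut, Real.smoothTransition.one_of_one_le]
  rw [le_sub_iff_add_le, le_div_iff₀ (by positivity)]
  nlinarith

/-- The radial cut-off vanishes up to `s = δ²/4`. [folklore] -/
theorem radCut_eq_zero {δ s : ℝ} (hδ : 0 < δ) (hs : s ≤ δ ^ 2 / 4) : radCut δ s = 0 := by
  rw [radCut, Real.smoothTransition.zero_of_nonpos]
  rw [sub_nonpos, div_le_one (by positivity)]
  nlinarith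

/-- The radial cut-off is smooth. [folklore] -/
theorem contDiff_radCut (δ : ℝ) : ContDiff ℝ ∞ (radCut δ) :=
  (Real.smoothTransition.contDiff (n := ⊤)).comp
    (((contDiff_const.mul contDiff_id).div_const _).sub contDiff_const)

/-- The unit direction `z / ‖z‖` of `z ∈ ℂ` (junk value `0` at `z = 0`). [folklore] -/
def udir (z : ℂ) : ℂ := ((‖z‖⁻¹ : ℝ) : ℂ) * z

/-- The unit direction has norm `1` off the origin. [folklore] -/
theorem norm_udir {z : ℂ} (hz : z ≠ 0) : ‖udir z‖ = 1 := by
  rw [udir, norm_mul, Complex.norm_real, norm_inv, norm_norm,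
    inv_mul_cancel₀ (norm_ne_zero_iff.2 hz)]

/-- A unit vector is its own direction. [folklore] -/
theorem udir_eq_self {z : ℂ} (hz : ‖z‖ = 1) : udir z = z := by
  rw [udir, hz, inv_one, Complex.ofReal_one, one_mul]

/-- Positive real multiples have the same direction. [folklore] -/
theorem udir_mul_of_pos {r : ℝ} (hr : 0 < r) (z : ℂ) : udir ((r : ℂ) * z) = udir z := by
  by_cases hz : z = 0
  · simp [udir, hz]
  · have hzn : ‖z‖ ≠ 0 := norm_ne_zero_iff.2 hz
    have hr' : (r : ℂ) ≠ 0 := by exact_mod_cast hr.ne'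
    have hzn' : ((‖z‖ : ℝ) : ℂ) ≠ 0 := by exact_mod_cast hzn
    rw [udir, udir, norm_mul, Complex.norm_real, Real.norm_of_nonneg hr.le, mul_inv, ← mul_assoc]
    congr 1
    push_cast
    field_simp

/-- `z = ‖z‖ · udir z`. [folklore] -/
theorem norm_mul_udir (z : ℂ) : ((‖z‖ : ℝ) : ℂ) * udir z = z := by
  by_cases hz : z = 0
  · simp [udir, hz]
  · rw [udir, ← mul_assoc, ← Complex.ofReal_mul, mul_inv_cancel₀ (norm_ne_zero_iff.2 hz),
      Complex.ofReal_one, one_mul]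

/-- The unit direction is smooth off the origin. [folklore] -/
theorem contDiffAt_udir {z : ℂ} (hz : z ≠ 0) : ContDiffAt ℝ ∞ udir z := by
  have h1 : ContDiffAt ℝ ∞ (fun u : ℂ => (‖u‖ : ℝ)⁻¹) z :=
    (contDiffAt_norm ℝ hz).inv (norm_ne_zero_iff.2 hz)
  exact (Complex.ofRealCLM.contDiff.contDiffAt.comp z h1).mul contDiffAt_id

/-- **The sector profile** `radCut δ ‖z‖² · B (z/‖z‖)`: the angular speed `B` read on the page
direction, cut off near `w = 0`. [folklore] -/
def secProfile (B : ℂ → ℝ) (δ : ℝ) (z : ℂ) : ℝ := radCut δ (‖z‖ ^ 2) * B (udir z)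

/-- Off the disc `‖z‖ < δ` the profile is the angular speed of the direction. [folklore] -/
theorem secProfile_of_le {B : ℂ → ℝ} {δ : ℝ} (hδ : 0 < δ) {z : ℂ} (hz : δ ≤ ‖z‖) :
    secProfile B δ z = B (udir z) := by
  rw [secProfile, radCut_eq_one hδ (by nlinarith [norm_nonneg z]), one_mul]

/-- The profile vanishes on `‖z‖ ≤ δ/2`. [folklore] -/
theorem secProfile_eq_zero_of_norm_le {B : ℂ → ℝ} {δ : ℝ} (hδ : 0 < δ) {z : ℂ}
    (hz : ‖z‖ ≤ δ / 2) : secProfile B δ z = 0 := by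
  rw [secProfile, radCut_eq_zero hδ (by nlinarith [norm_nonneg z]), zero_mul]

/-- The profile vanishes where the angular speed of the direction does. [folklore] -/
theorem secProfile_eq_zero_of_apply {B : ℂ → ℝ} (δ : ℝ) {z : ℂ} (hz : B (udir z) = 0) :
    secProfile B δ z = 0 := by
  rw [secProfile, hz, mul_zero]

/-- **The sector profile is smooth on `ℂ`** (it vanishes near the origin, where the direction is
singular). [folklore] -/
theorem contDiff_secProfile {B : ℂ → ℝ} (hB : ContDiff ℝ ∞ B) {δ : ℝ} (hδ : 0 < δ) :
    ContDiff ℝ ∞ (secProfile B δ) := by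
  refine contDiff_iff_contDiffAt.2 fun z => ?_
  by_cases hz : ‖z‖ < δ / 2
  · refine (contDiffAt_const (c := (0 : ℝ))).congr_of_eventuallyEq ?_
    filter_upwards [(isOpen_lt continuous_norm continuous_const).mem_nhds hz] with u hu
    exact secProfile_eq_zero_of_norm_le hδ (le_of_lt hu)
  · have hz0 : z ≠ 0 := by
      rintro rfl
      exact hz (by rw [norm_zero]; positivity)
    exact (((contDiff_radCut δ).contDiffAt).comp z ((contDiffAt_id.norm_sq ℝ))).mul
      (hB.contDiffAt.comp z (contDiffAt_udir hz0))

/-- On the unit circle the profile with `δ = 1` is `B` itself. [folklore] -/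
theorem secProfile_one_of_norm_eq_one {B : ℂ → ℝ} {z : ℂ} (hz : ‖z‖ = 1) :
    secProfile B 1 z = B z := by
  rw [secProfile_of_le one_pos hz.ge, udir_eq_self hz]

/-! ## §2 The unit-direction ODE along the flow lines -/

section Flow

variable {g : ℕ} {B : ℂ → ℝ} {δ : ℝ} {θ : ℝ × EuclideanSpace ℝ (Fin 4) → EuclideanSpace ℝ (Fin 4)}
  (hder : ∀ x t, HasDerivAt (fun t => θ (t, x)) (rotFieldA g (secProfile B δ) (θ (t, x))) t)
  (h0 : ∀ x, θ (0, x) = x)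
include hder h0

/-- **The normalised page coordinate solves the unit-circle ODE**: for a point of
`{rho ≤ 3/10}` with `‖w‖ ≥ δ`, `u(t) = w(θ(t,x)) / ‖w(x)‖` satisfies
`u' = rotODE (secProfile B 1) u` (`= B(u) · i · u`, since `‖u‖ = 1`). [folklore] -/
theorem hasDerivAt_unitDir (hδ : 0 < δ) {x : EuclideanSpace ℝ (Fin 4)} (hx : rho g x ≤ 3 / 10)
    (hδx : δ ≤ ‖w g x‖) (t : ℝ) :
    HasDerivAt (fun s => ((‖w g x‖⁻¹ : ℝ) : ℂ) * w g (θ (s, x)))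
      (rotODE (secProfile B 1) (((‖w g x‖⁻¹ : ℝ) : ℂ) * w g (θ (t, x)))) t := by
  have hρ0 : rho g (θ (0, x)) ≤ 3 / 10 := by rw [h0]; exact hx
  have hn : ‖w g (θ (t, x))‖ = ‖w g x‖ := by
    have h := norm_w_flowline_eq (hder x) hρ0 t
    rwa [h0] at h
  have hx0 : 0 < ‖w g x‖ := hδ.trans_le hδx
  have h1 := (hasDerivAt_w_flowline (hder x) hρ0 t).const_mul (((‖w g x‖⁻¹ : ℝ) : ℂ))
  refine h1.congr_deriv ?_
  have hnorm : ‖((‖w g x‖⁻¹ : ℝ) : ℂ) * w g (θ (t, x))‖ = 1 := by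
    rw [norm_mul, Complex.norm_real, norm_inv, norm_norm, hn, inv_mul_cancel₀ hx0.ne']
  rw [rotODE, secProfile_one_of_norm_eq_one hnorm, secProfile_of_le hδ (hn ▸ hδx),
    ← udir_mul_of_pos (inv_pos.2 hx0) (w g (θ (t, x))), udir_eq_self hnorm]
  ring

/-- The normalised page coordinate stays in the closed unit disc. [folklore] -/
theorem unitDir_mem_closedBall (hδ : 0 < δ) {x : EuclideanSpace ℝ (Fin 4)} (hx : rho g x ≤ 3 / 10)
    (hδx : δ ≤ ‖w g x‖) (t : ℝ) :
    ((‖w g x‖⁻¹ : ℝ) : ℂ) * w g (θ (t, x)) ∈ closedBall (0 : ℂ) 1 := by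
  have hn : ‖w g (θ (t, x))‖ = ‖w g x‖ := by
    have h := norm_w_flowline_eq (hder x) (by rw [h0]; exact hx) t
    rwa [h0] at h
  rw [mem_closedBall, dist_zero_right, norm_mul, Complex.norm_real, norm_inv, norm_norm, hn,
    inv_mul_cancel₀ (hδ.trans_le hδx).ne']

/-- **Exact fibredness off the binding**: two points of `{rho ≤ 3/10}` with `‖w‖ ≥ δ` on a
common `w`-ray stay on a common ray, with the same ratio, at all times.
[cite: LeeSmoothManifolds2013, Thm. 9.12] -/
theorem w_flow_eq_mul_of_w_eq_mul (hB : ContDiff ℝ ∞ B) (hδ : 0 < δ)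
    {x y : EuclideanSpace ℝ (Fin 4)} (hx : rho g x ≤ 3 / 10) (hy : rho g y ≤ 3 / 10)
    (hδx : δ ≤ ‖w g x‖) (hδy : δ ≤ ‖w g y‖) {r : ℝ} (hr : 0 < r)
    (hxy : w g y = (r : ℂ) * w g x) (t : ℝ) : w g (θ (t, y)) = (r : ℂ) * w g (θ (t, x)) := by
  obtain ⟨K, hK⟩ := exists_lipschitzOnWith_rotODE (contDiff_secProfile hB one_pos)
  have hx0 : 0 < ‖w g x‖ := hδ.trans_le hδx
  have hy0 : 0 < ‖w g y‖ := hδ.trans_le hδy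
  have hny : ‖w g y‖ = r * ‖w g x‖ := by
    rw [hxy, norm_mul, Complex.norm_real, Real.norm_of_nonneg hr.le]
  have hinit : (fun s => ((‖w g x‖⁻¹ : ℝ) : ℂ) * w g (θ (s, x))) 0 =
      (fun s => ((‖w g y‖⁻¹ : ℝ) : ℂ) * w g (θ (s, y))) 0 := by
    show ((‖w g x‖⁻¹ : ℝ) : ℂ) * w g (θ (0, x)) = ((‖w g y‖⁻¹ : ℝ) : ℂ) * w g (θ (0, y))
    rw [h0, h0, hny, hxy, ← mul_assoc]
    congr 1
    have hr' : (r : ℂ) ≠ 0 := by exact_mod_cast hr.ne'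
    have hx0' : ((‖w g x‖ : ℝ) : ℂ) ≠ 0 := by exact_mod_cast hx0.ne'
    push_cast
    field_simp
  have key : (fun s => ((‖w g x‖⁻¹ : ℝ) : ℂ) * w g (θ (s, x))) =
      fun s => ((‖w g y‖⁻¹ : ℝ) : ℂ) * w g (θ (s, y)) :=
    ODE_solution_unique_univ (v := fun _ => rotODE (secProfile B 1))
      (s := fun _ => closedBall (0 : ℂ) 1) (t₀ := 0) (fun _ => hK)
      (fun s => ⟨hasDerivAt_unitDir hder h0 hδ hx hδx s, unitDir_mem_closedBall hder h0 hδ hx hδx s⟩)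
      (fun s => ⟨hasDerivAt_unitDir hder h0 hδ hy hδy s, unitDir_mem_closedBall hder h0 hδ hy hδy s⟩)
      hinit
  have h : ((‖w g x‖⁻¹ : ℝ) : ℂ) * w g (θ (t, x)) = ((‖w g y‖⁻¹ : ℝ) : ℂ) * w g (θ (t, y)) :=
    congrFun key t
  calc w g (θ (t, y)) = ((‖w g y‖ : ℝ) : ℂ) * (((‖w g y‖⁻¹ : ℝ) : ℂ) * w g (θ (t, y))) := by
        rw [← mul_assoc, ← Complex.ofReal_mul, mul_inv_cancel₀ hy0.ne', Complex.ofReal_one, one_mul]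
    _ = ((‖w g y‖ : ℝ) : ℂ) * (((‖w g x‖⁻¹ : ℝ) : ℂ) * w g (θ (t, x))) := by rw [h]
    _ = (r : ℂ) * w g (θ (t, x)) := by
        rw [hny, ← mul_assoc, ← Complex.ofReal_mul, mul_assoc r, mul_inv_cancel₀ hx0.ne', mul_one]

/-- **Plateaux rotate rigidly**: if the angular speed is the constant `κ` on the arc
`e^{i(φ₀ + κ s)}`, `s ∈ [0, T]`, then a point of `{rho ≤ 3/10}` with `w = ‖w‖ e^{iφ₀}`, `‖w‖ ≥ δ`
has `w (θ (t, x)) = ‖w‖ e^{i(φ₀ + κ t)}` for `t ∈ [0, T]`. [cite: LeeSmoothManifolds2013, Thm. 9.12] -/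
theorem w_flow_eq_exp (hB : ContDiff ℝ ∞ B) (hδ : 0 < δ) {κ φ₀ T : ℝ}
    (hplat : ∀ s ∈ Icc (0 : ℝ) T, B (Complex.exp (((φ₀ + κ * s : ℝ) : ℂ) * Complex.I)) = κ)
    {x : EuclideanSpace ℝ (Fin 4)} (hx : rho g x ≤ 3 / 10) (hδx : δ ≤ ‖w g x‖)
    (hφ : w g x = ((‖w g x‖ : ℝ) : ℂ) * Complex.exp ((φ₀ : ℂ) * Complex.I)) {t : ℝ}
    (ht : t ∈ Icc (0 : ℝ) T) :
    w g (θ (t, x)) = ((‖w g x‖ : ℝ) : ℂ) * Complex.exp (((φ₀ + κ * t : ℝ) : ℂ) * Complex.I) := by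
  obtain ⟨K, hK⟩ := exists_lipschitzOnWith_rotODE (contDiff_secProfile hB one_pos)
  have hx0 : 0 < ‖w g x‖ := hδ.trans_le hδx
  have hφ' : ((‖w g x‖⁻¹ : ℝ) : ℂ) * w g x = Complex.exp ((φ₀ : ℂ) * Complex.I) := by
    have h1 : ((‖w g x‖⁻¹ : ℝ) : ℂ) * w g x =
        ((‖w g x‖⁻¹ : ℝ) : ℂ) * (((‖w g x‖ : ℝ) : ℂ) * Complex.exp ((φ₀ : ℂ) * Complex.I)) :=
      congrArg (fun z => ((‖w g x‖⁻¹ : ℝ) : ℂ) * z) hφ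
    rw [h1, ← mul_assoc, ← Complex.ofReal_mul, inv_mul_cancel₀ hx0.ne', Complex.ofReal_one, one_mul]
  -- the explicit candidate
  set f : ℝ → ℂ := fun s => Complex.exp (((φ₀ + κ * s : ℝ) : ℂ) * Complex.I) with hf
  have hfn : ∀ s, ‖f s‖ = 1 := fun s => by
    simp only [hf, Complex.norm_exp_ofReal_mul_I]
  have hfd : ∀ s, HasDerivAt f (((κ : ℝ) : ℂ) * (Complex.I * f s)) s := by
    intro s
    have h1 : HasDerivAt (fun s : ℝ => ((φ₀ + κ * s : ℝ) : ℂ) * Complex.I) (((κ : ℝ) : ℂ) * Complex.I) s := by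
      have h := (((hasDerivAt_id s).const_mul κ).const_add φ₀).ofReal_comp.mul_const Complex.I
      simpa using h
    exact h1.cexp.congr_deriv (by simp only [hf]; ring)
  have hsol : ∀ s ∈ Ico (0 : ℝ) T, HasDerivWithinAt f (rotODE (secProfile B 1) (f s)) (Ici s) s := by
    intro s hs
    have e : rotODE (secProfile B 1) (f s) = ((κ : ℝ) : ℂ) * (Complex.I * f s) := by
      rw [rotODE, secProfile_one_of_norm_eq_one (hfn s), hplat s (Ico_subset_Icc_self hs)]
    rw [e]
    exact (hfd s).hasDerivWithinAt
  have key := ODE_solution_unique_of_mem_Icc_right (v := fun _ => rotODE (secProfile B 1))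
    (s := fun _ => closedBall (0 : ℂ) 1)
    (f := fun s => ((‖w g x‖⁻¹ : ℝ) : ℂ) * w g (θ (s, x))) (g := f) (a := 0) (b := T)
    (fun _ _ => hK) (HasDerivAt.continuousOn fun s _ => hasDerivAt_unitDir hder h0 hδ hx hδx s)
    (fun s _ => (hasDerivAt_unitDir hder h0 hδ hx hδx s).hasDerivWithinAt)
    (fun s _ => unitDir_mem_closedBall hder h0 hδ hx hδx s)
    (HasDerivAt.continuousOn fun s _ => hfd s) hsol
    (fun s _ => mem_closedBall_zero_iff.2 (hfn s).le)
    (by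
      show ((‖w g x‖⁻¹ : ℝ) : ℂ) * w g (θ (0, x)) = f 0
      rw [h0, hφ']
      simp [hf])
  have h : ((‖w g x‖⁻¹ : ℝ) : ℂ) * w g (θ (t, x)) = f t := key ht
  calc w g (θ (t, x)) = ((‖w g x‖ : ℝ) : ℂ) * (((‖w g x‖⁻¹ : ℝ) : ℂ) * w g (θ (t, x))) := by
        rw [← mul_assoc, ← Complex.ofReal_mul, mul_inv_cancel₀ hx0.ne', Complex.ofReal_one, one_mul]
    _ = ((‖w g x‖ : ℝ) : ℂ) * f t := by rw [h]

end Flow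

/-! ## §3 The sector rotation: flow level and base level -/

/-- **The flow of the sector profile, with all its clauses** (flow `θ` of `ℝ⁴` and its restriction
`R` to `Base g`): the clauses of `helper_rotFlow_fix` for `a = secProfile B δ`, invariance of the
flat part and of `‖w‖`, the fixed directions (`B (w/‖w‖) = 0` or `w = 0`), exact fibredness on
`{‖w‖ ≥ δ}` (rays to rays with the same ratio) and rigid rotation of plateaux of `B`.
[cite: GompfStipsicz1999, §8.2] -/
theorem rotFlow_sector (g : ℕ) {B : ℂ → ℝ} (hB : ContDiff ℝ ∞ B) {δ : ℝ} (hδ : 0 < δ) :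
    ∃ (R : AmbientIsotopy (𝓡∂ 4) (Base g)) (θ : ℝ × EuclideanSpace ℝ (Fin 4) → EuclideanSpace ℝ (Fin 4)),
      ContDiff ℝ ∞ θ ∧ (∀ x, θ (0, x) = x) ∧ (∀ t s x, θ (t, θ (s, x)) = θ (t + s, x)) ∧
      (∀ (t : ℝ) (x : Base g), (R.toFun t x).1 = θ (t, x.1)) ∧
      (∀ x t, HasDerivAt (fun t => θ (t, x)) (rotFieldA g (secProfile B δ) (θ (t, x))) t) ∧
      (∀ t x, rho g (θ (t, x)) = rho g x) ∧
      (∀ t x, ‖cx (θ (t, x))‖ ^ 2 < 4 ↔ ‖cx x‖ ^ 2 < 4) ∧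
      (∀ x, rho g x ≤ 3 / 10 → ∀ t, ‖w g (θ (t, x))‖ = ‖w g x‖) ∧
      (∀ x, B (udir (w g x)) = 0 → ∀ t, θ (t, x) = x) ∧
      (∀ x, w g x = 0 → ∀ t, θ (t, x) = x) ∧
      (∀ x y, rho g x ≤ 3 / 10 → rho g y ≤ 3 / 10 → δ ≤ ‖w g x‖ → δ ≤ ‖w g y‖ →
        ∀ r : ℝ, 0 < r → w g y = (r : ℂ) * w g x → ∀ t, w g (θ (t, y)) = (r : ℂ) * w g (θ (t, x))) ∧
      (∀ (κ φ₀ T : ℝ), (∀ s ∈ Icc (0 : ℝ) T, B (Complex.exp (((φ₀ + κ * s : ℝ) : ℂ) * Complex.I)) = κ) →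
        ∀ x, rho g x ≤ 3 / 10 → δ ≤ ‖w g x‖ →
          w g x = ((‖w g x‖ : ℝ) : ℂ) * Complex.exp ((φ₀ : ℂ) * Complex.I) →
          ∀ t ∈ Icc (0 : ℝ) T,
            w g (θ (t, x)) = ((‖w g x‖ : ℝ) : ℂ) * Complex.exp (((φ₀ + κ * t : ℝ) : ℂ) * Complex.I)) := by
  have ha : ContDiff ℝ ∞ (secProfile B δ) := contDiff_secProfile hB hδ
  obtain ⟨R, θ, hθ, h0, hadd, hR, hder, hrho, hfix, -⟩ := helper_rotFlow_fix g (secProfile B δ) ha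
  refine ⟨R, θ, hθ, h0, hadd, hR, hder, hrho, fun t x => ?_, fun x hx t => ?_,
    fun x hx => hfix x (secProfile_eq_zero_of_apply δ hx),
    fun x hx => hfix x (by rw [hx]; exact secProfile_eq_zero_of_norm_le hδ (by simp; positivity)),
    fun x y hx hy hδx hδy r hr hxy t => w_flow_eq_mul_of_w_eq_mul hder h0 hB hδ hx hy hδx hδy hr hxy t,
    fun κ φ₀ T hplat x hx hδx hφ t ht => w_flow_eq_exp hder h0 hB hδ hplat hx hδx hφ ht⟩
  · have h := norm_sq_cx_flowline_lt_four_iff (hder x) t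
    rwa [h0] at h
  · have h := norm_w_flowline_eq (hder x) (by rw [h0]; exact hx) t
    rwa [h0] at h

/-- **(N1-rot) The sector-supported fibred page rotation of the Lefschetz base** (registered
sub-goal `helper_rotFlow_sector` of `stub_M2geo`): for every smooth angular speed `B : ℂ → ℝ`
(read on the page direction `w/‖w‖`) and `0 < δ ≤ 1/2` there is an ambient isotopy `R` of `Base g`
which preserves `rho`, the flat part `‖x‖² < 4` and `‖w‖`; FIXES every point whose page direction
`u` has `B u = 0` and every binding point `w = 0` (so the pages outside the support of `B` — the
other handles of a Lefschetz link — do not move); is EXACTLY FIBRED off the binding collar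
`‖w‖ < δ` (points on a common `w`-ray stay on a common ray with the same ratio; in particular every
flat page is carried into a flat page); and rotates every plateau of `B` rigidly (`B = κ` on the
arc `e^{i(φ₀+κs)}`, `s ∈ [0,T]` ⇒ the page of direction `e^{iφ₀}` is at direction `e^{i(φ₀+κt)}` at
time `t ≤ T`).  This is the base-level engine of one Hurwitz move (one handle dragged through a
free sector of pages, Gompf–Stipsicz 1999 §8.2, on Kas' handlebody).
[cite: GompfStipsicz1999, §8.2] -/
theorem helper_rotFlow_sector : ∀ (g : ℕ) (B : ℂ → ℝ), ContDiff ℝ ∞ B → ∀ (δ : ℝ), 0 < δ → δ ≤ 1 / 2 → ∃ R : Literature.Topology.FourManifolds.AmbientIsotopy (𝓡∂ 4) (Literature.Topology.FourManifolds.LefschetzBase.Base g), (∀ (t : ℝ) (x : Literature.Topology.FourManifolds.LefschetzBase.Base g), Literature.Topology.FourManifolds.LefschetzBase.rho g (R.toFun t x).1 = Literature.Topology.FourManifolds.LefschetzBase.rho g x.1) ∧ (∀ (t : ℝ) (x : Literature.Topology.FourManifolds.LefschetzBase.Base g), ‖Literature.Topology.FourManifolds.LefschetzBase.cx (R.toFun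 t x).1‖ ^ 2 < 4 ↔ ‖Literature.Topology.FourManifolds.LefschetzBase.cx x.1‖ ^ 2 < 4) ∧ (∀ (t : ℝ) (x : Literature.Topology.FourManifolds.LefschetzBase.Base g), ‖Literature.Topology.FourManifolds.LefschetzBase.w g (R.toFun t x).1‖ = ‖Literature.Topology.FourManifolds.LefschetzBase.w g x.1‖) ∧ (∀ x : Literature.Topology.FourManifolds.LefschetzBase.Base g, B (((‖Literature.Topology.FourManifolds.LefschetzBase.w g x.1‖⁻¹ : ℝ) : ℂ) * Literature.Topology.FourManifolds.LefschetzBase.w g x.1) = 0 → ∀ t : ℝ, R.toFun t x = x) ∧ (∀ x : Literature.Topology.FourManifolds.LefschetzBase.Base g, Literature.Topology.FourManifolds.LefschetzBase.w g x.1 = 0 → ∀ t : ℝ, R.toFun t x = x) ∧ (∀ x y : Literature.Topology.FourManifolds.LefschetzBase.Base g, δ ≤ ‖Literature.Topology.FourManifolds.LefschetzBase.w g x.1‖ → δ ≤ ‖Literature.Topology.FourManifolds.LefschetzBase.w g y.1‖ → ∀ r : ℝ, 0 < r → Literature.Topology.FourManifolds.LefschetzBase.w g y.1 = (r : ℂ)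 * Literature.Topology.FourManifolds.LefschetzBase.w g x.1 → ∀ t : ℝ, Literature.Topology.FourManifolds.LefschetzBase.w g (R.toFun t y).1 = (r : ℂ) * Literature.Topology.FourManifolds.LefschetzBase.w g (R.toFun t x).1) ∧ (∀ (t : ℝ) (c : ℂ), ‖c‖ = 1 → ∃ c' : ℂ, ‖c'‖ = 1 ∧ ∀ x : Literature.Topology.FourManifolds.LefschetzBase.Base g, x ∈ Literature.Topology.FourManifolds.LefschetzBase.page g c → R.toFun t x ∈ Literature.Topology.FourManifolds.LefschetzBase.page g c') ∧ (∀ (κ φ₀ T : ℝ), (∀ s ∈ Set.Icc (0 : ℝ) T, B (Complex.exp (((φ₀ + κ * s : ℝ) : ℂ) * Complex.I)) = κ) → ∀ x : Literature.Topology.FourManifolds.LefschetzBase.Base g, δ ≤ ‖Literature.Topology.FourManifolds.LefschetzBase.w g x.1‖ → Literature.Topology.FourManifolds.LefschetzBase.w g x.1 = ((‖Literature.Topology.FourManifolds.LefschetzBase.w g x.1‖ : ℝ) : ℂ) * Complex.exp ((φ₀ : ℂ) * Complex.I) → ∀ t ∈ Set.Icc (0 : ℝ) T, Literature.Topology.FourManifolds.LefschetzBase.w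 g (R.toFun t x).1 = ((‖Literature.Topology.FourManifolds.LefschetzBase.w g x.1‖ : ℝ) : ℂ) * Complex.exp (((φ₀ + κ * t : ℝ) : ℂ) * Complex.I)) := by
  intro g B hB δ hδ hδ2
  obtain ⟨R, θ, -, h0, -, hR, hder, hrho, hflat, hnorm, hfixB, hfix0, hray, hplat⟩ :=
    rotFlow_sector g hB hδ
  have hρ : ∀ x : Base g, rho g x.1 ≤ 3 / 10 := fun x => x.2.trans (by norm_num)
  refine ⟨R, fun t x => by rw [hR, hrho], fun t x => by rw [hR, hflat], fun t x => by rw [hR, hnorm _ (hρ x)],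
    fun x hx t => Subtype.ext (by rw [hR]; exact hfixB x.1 hx t),
    fun x hx t => Subtype.ext (by rw [hR]; exact hfix0 x.1 hx t),
    fun x y hδx hδy r hr hxy t => by rw [hR, hR]; exact hray x.1 y.1 (hρ x) (hρ y) hδx hδy r hr hxy t,
    fun t c hc => ?_,
    fun κ φ₀ T hp x hδx hφ t ht => by rw [hR]; exact hplat κ φ₀ T hp x.1 (hρ x) hδx hφ t ht⟩
  -- the fibred clause on flat pages: same `w`, same trajectory of `w`
  by_cases hne : (page g c).Nonempty
  · obtain ⟨x₀, hx₀⟩ := hne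
    refine ⟨2 * w g (θ (t, x₀.1)), ?_, fun x hx => ⟨?_, ?_⟩⟩
    · rw [norm_mul, Complex.norm_two, hnorm _ (hρ x₀), hx₀.2, norm_div, hc, Complex.norm_two]
      norm_num
    · show ‖cx (R.toFun t x).1‖ ^ 2 < 4
      rw [hR, hflat]
      exact hx.1
    · show w g (R.toFun t x).1 = 2 * w g (θ (t, x₀.1)) / 2
      rw [hR, w_flow_eq_of_w_eq hder h0 (contDiff_secProfile hB hδ) (hρ x) (hρ x₀)
        (hx.2.trans hx₀.2.symm) t]
      ring
  · exact ⟨c, hc, fun x hx => absurd ⟨x, hx⟩ hne⟩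

end Summit.SmoothPoincare4.SmoothPoincare4.Theorems.AcyclicBisectionExists.ModpBraidOrbits

end
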